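/-
Copyright (c) 2026 the pub-hodgecm-mathlib formalisation cell (harness21).  Prover seat hodgecm-mathlib-K2E1-p15 (g3), Track B ∕ K2-LIT, h413 = `stmt-HodgeConjecture-24833`,
R90-TF section S8 «ContSpec-n½», #4′ road, letter (O) of the LAYER 2 PRINT ★ p862113 (deal S8-R29 (3) ∕ S8-R35 (2) ∕ S8-R38 (1) 2026-09-04T22:18:47Z «(O) next with the honest
cross-block hypothesis shape»): RESIDUE ATOMS ⟂ LINE PARTS, `(⨆_b At_b) ⟂ (⨆_b Ln_b)`, in the def regime R1 of record (★∕📤 `R90S8ResHBlockDataU2Defs`).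
-/
import Summits.HodgeConjecture.HodgeConjecture.Theorems.R90S8ResHBlockDataU2Defs                                -- 📤 p862464 (this seat): `resHBlock` ∕ `resHAtom` ∕ `resHLine` + read-backs (`isOrtho_resHAtom_resHLine`, `resHAtom_le_resHBlock`, `resHLine_le_resHBlock`)
import Summits.HodgeConjecture.HodgeConjecture.Theorems.K2E1ChiPseudoEisensteinFamiliesOrthogonalRayTrivialCMTwo   -- ★ p861714 (K2E1-p16) R6: `isOrtho_topologicalClosure_span_family_of_rayTrivial_of_ne` (block orthogonality, ray-trivial `χ ≠ χ′`, `χ ≠ χ′ʷ`)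
import HarnessLib

/-!
# S8 #4′ road, letter (O) — `R90S8ResHResiduesOrthogonalWavePacketsU2`: `(⨆_b At(U_b; K′, ω, χ_b)) ⟂ (⨆_b Ln(U_b; K′, ω, χ_b))` — the orthogonality letter `hO` of ★
# `residual_le_topologicalClosure_iSup_charLines_of_letters`, in regime R1

Track B ∕ K2-LIT, crux h413 = `stmt-HodgeConjecture-24833`, route of record `HCCMUnconditional`; cell `hodgecm-mathlib`, R90-TF programme, section S8 «ContSpec-n½», socket #4′
`sock_S8_resH_spannedByCharLines` (B ED. 4 :256).  THEOREMS ONLY (no `def`, no `instance`, no `notation`, no named-fact hypothesis, no `sorry`; default heartbeats); lane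
`--supports stmt-HodgeConjecture-24833 --as helper` (count-neutral).  CLOSES NO SOCKET: it pays letter (O) `hO : ∀ ℓ, (⨆ b, At ℓ b) ⟂ (⨆ b, Ln ℓ b)` (★ p862113 :89) at the defs of
record `At ℓ b := resHAtom L μ (U ℓ b) (K' ℓ) (ω ℓ) ↑b`, `Ln ℓ b := resHLine L μ (U ℓ b) (K' ℓ) (ω ℓ) ↑b` (regime R1, S8-R35 (1)), GENERIC in the level datum `(K', ω)` (LETTER SHAPE
RULE S8-R29 (2)) and for an ARBITRARY block-model family `U b : L² →ₗ[ℂ] A b × Λ b`, modulo the visible letters listed below.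

THE MATHEMATICS ([MoeglinWaldspurger1995, II.2.1 (pseudo-Eisenstein series of non-associate cuspidal data are orthogonal), VI.2]; [TateThesis1967, §4.3]).  In regime R1 the line part
of a block is the orthocomplement of its pure atoms INSIDE the block, `Ln_b = Sc_b ⊓ At_bᗮ`, so `At_b ⟂ Ln_b` holds by definition (★ read-back `isOrtho_resHAtom_resHLine`).  Across two
blocks `b ≠ b′` of the C7 index `S_ω(K′) = {χ ray-trivial, V(χ, K′, ω) ≠ ⊥}`: if `χ_b ≠ χ_{b′}ʷ` the whole blocks are orthogonal, `At_b ≤ Sc_b ⟂ Sc_{b′} ≥ Ln_{b′}` (★ R6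
`isOrtho_topologicalClosure_span_family_of_rayTrivial_of_ne`, [MW II.2.1]); if `χ_b = χ_{b′}ʷ` with `b ≠ b′` (the ASSOCIATE pair — the two blocks then COINCIDE and block orthogonality
cannot serve) then `χ_bʷ = χ_{b′} ≠ χ_b`, i.e. `χ_b` is OFF-DUAL, and an off-dual block model has no atom coordinates: `At_b = ⊥` (the model letter `hOD`).  Hence `(⨆_b At_b) ⟂ (⨆_b Ln_b)`
(Mathlib `Submodule.isOrtho_iSup_left ∕ _right`).
* §1 `isOrtho_iSup_resHAtom_iSup_resHLine_of_pairwise` — GENERIC ASSEMBLY (any index type `β`, any `χ : β → HeckeCharacter L`, any model family): the pairwise cross-block clause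
  `∀ b ≠ b′, At_b ⟂ Sc_{b′}` gives `hO`'s shape; `resHAtom_isOrtho_resHBlock_of_isOrtho` (from block orthogonality) and `resHAtom_isOrtho_of_eq_bot` (from `At = ⊥`) discharge the clause.
* §2 **`isOrtho_iSup_resHAtom_iSup_resHLine_of_letters`** — THE PAYMENT at the C7 index `S_ω(K′)`: VISIBLE LETTERS = (XF)'s structural Haar ∕ fundamental-domain data `νG μK νI 𝓕I ν 𝓕`
  (★ R6's, unchanged), unitarity `hu` and the bounded-section letter `hχb` per index (★ R6's `hχu ∕ hχb`), and the model letter `hOD` «an off-dual block has no pure atoms» in the pairwise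
  spelling `b ≠ b′ → χ_b = χ_{b′}ʷ → At_b = ⊥`; **`isOrtho_iSup_resHAtom_iSup_resHLine_of_letters'`** — the same with `hOD` in the intrinsic spelling `χ_bʷ ≠ χ_b → At_b = ⊥` (uses the
  print's `hc : c·c = 1` through ★ `reflectChar_reflectChar`).
CONSUMER (H7): `hO := fun ℓ => isOrtho_iSup_resHAtom_iSup_resHLine_of_letters' L μ νG μK νI h𝓕I ν h𝓕N h𝓕c h𝓕₀ hc (K' ℓ) (ω ℓ) (U ℓ) (hu ℓ) (hχb ℓ) (hOD ℓ)`.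
HONEST LABEL: HC_CM is proved only modulo the 7 printed citations (2 remaining named inputs: hLiu418 = `stmt-HodgeConjecture-24832`, h413 = `stmt-HodgeConjecture-24833`) until
rung 0 closes; REL ≠ ★ ≠ BUILT; this file asserts no named fact, is conditional by construction on its visible binders, and closes no socket; count-neutral.

## References
* [MoeglinWaldspurger1995] C. Mœglin, J.-L. Waldspurger, *Spectral Decomposition and Eisenstein Series* (1995), II.2.1, VI.2.
* [TateThesis1967] J. Tate, *Fourier analysis in number fields and Hecke's zeta-functions*, in Cassels–Fröhlich (1967), §4.3.
-/

set_option autoImplicit false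
set_option linter.dupNamespace false  -- the mandated namespace `…HodgeConjecture.HodgeConjecture.R90.S8` (LEAD #1 L1) repeats the summit's segment

noncomputable section

open MeasureTheory Measure Set Filter Topology NumberField IsDedekindDomain
open Literature.NumberTheory.Automorphic Literature.NumberTheory.Automorphic.UnitaryGroup Literature.NumberTheory.GaloisRepresentations AdelicGroupData
open Summit.HodgeConjecture.HodgeConjecture.Cruxes.H413.K2E1BorelEisensteinU
open Summit.HodgeConjecture.HodgeConjecture.Cruxes.H413.K2E1CharacterEisensteinU2Defs
open Summit.HodgeConjecture.HodgeConjecture.Cruxes.H413.K2E1ChiSectionSpaceU2Defs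
open Summit.HodgeConjecture.HodgeConjecture.Cruxes.H413.K2E1ChiPseudoEisensteinFamiliesOrthogonalRayTrivialCMTwo (isOrtho_topologicalClosure_span_family_of_rayTrivial_of_ne)
open scoped ENNReal NNReal InnerProductSpace

namespace Summit.HodgeConjecture.HodgeConjecture.R90.S8

variable (L : Type) [Field L] [NumberField L] [IsCMField L]
  (μ : Measure (quasiSplit (↥(maximalRealSubfield L)) L (IsCMField.complexConj L) 2).automorphicQuotient)

/-! ## §1 Generic assembly: pairwise cross-block orthogonality ⟹ `(⨆ At) ⟂ (⨆ Ln)` -/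

section Assembly

variable {β : Type*} {A Λ : β → Type*} [∀ b, AddCommGroup (A b)] [∀ b, Module ℂ (A b)] [∀ b, AddCommGroup (Λ b)] [∀ b, Module ℂ (Λ b)]

/-- **GENERIC ASSEMBLY OF (O)**: for any block-model family `U b`, any level datum `(K′, ω)` and any block map `χ : β → HeckeCharacter L`, if the pure atoms of each block are orthogonal to
every OTHER block (`∀ b ≠ b′, At_b ⟂ Sc_{b′}`), then `(⨆_b At_b) ⟂ (⨆_b Ln_b)` — in-block by ★ `isOrtho_resHAtom_resHLine` (`Ln_b = Sc_b ⊓ At_bᗮ`), cross-block because `Ln_{b′} ≤ Sc_{b′}`.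
[cite: MoeglinWaldspurger1995, VI.2] -/
theorem isOrtho_iSup_resHAtom_iSup_resHLine_of_pairwise
    (U : ∀ b : β, (quasiSplit (↥(maximalRealSubfield L)) L (IsCMField.complexConj L) 2).L2 μ →ₗ[ℂ] A b × Λ b)
    (K' : Subgroup (quasiSplit (↥(maximalRealSubfield L)) L (IsCMField.complexConj L) 2).Adelic) (ω : ↥K' →* ℂ) (χ : β → HeckeCharacter L)
    (hsep : ∀ b b' : β, b ≠ b' → resHAtom L μ (U b) K' ω (χ b) ⟂ resHBlock L μ K' ω (χ b')) :
    (⨆ b, resHAtom L μ (U b) K' ω (χ b)) ⟂ (⨆ b, resHLine L μ (U b) K' ω (χ b)) := by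
  classical
  refine Submodule.isOrtho_iSup_left.2 fun b => Submodule.isOrtho_iSup_right.2 fun b' => ?_
  by_cases h : b = b'
  · subst h
    exact isOrtho_resHAtom_resHLine L μ (U b) K' ω (χ b)
  · exact (hsep b b' h).mono_right (resHLine_le_resHBlock L μ (U b') K' ω (χ b'))

end Assembly

section Pair

variable {A Λ : Type*} [AddCommGroup A] [Module ℂ A] [AddCommGroup Λ] [Module ℂ Λ]
  (U : (quasiSplit (↥(maximalRealSubfield L)) L (IsCMField.complexConj L) 2).L2 μ →ₗ[ℂ] A × Λ)
  (K' : Subgroup (quasiSplit (↥(maximalRealSubfield L)) L (IsCMField.complexConj L) 2).Adelic) (ω : ↥K' →* ℂ)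

/-- The cross-block clause from BLOCK ORTHOGONALITY: `Sc_χ ⟂ Sc_{χ′} ⟹ At_χ ⟂ Sc_{χ′}` (`At ≤ Sc`). [cite: MoeglinWaldspurger1995, II.2.1] -/
theorem resHAtom_isOrtho_resHBlock_of_isOrtho {χ χ' : HeckeCharacter L} (h : resHBlock L μ K' ω χ ⟂ resHBlock L μ K' ω χ') :
    resHAtom L μ U K' ω χ ⟂ resHBlock L μ K' ω χ' :=
  h.mono_left (resHAtom_le_resHBlock L μ U K' ω χ)

/-- The cross-block clause for a block WITHOUT PURE ATOMS: `At_χ = ⊥ ⟹ At_χ ⟂ V` for every `V` (off-dual blocks). [folklore] -/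
theorem resHAtom_isOrtho_of_eq_bot {χ : HeckeCharacter L} (h : resHAtom L μ U K' ω χ = ⊥)
    (V : Submodule ℂ ((quasiSplit (↥(maximalRealSubfield L)) L (IsCMField.complexConj L) 2).L2 μ)) : resHAtom L μ U K' ω χ ⟂ V := by
  rw [h]
  exact Submodule.isOrtho_bot_left

end Pair

/-! ## §2 The payment at the C7 index `S_ω(K′) = {χ ray-trivial, V(χ, K′, ω) ≠ ⊥}` -/

section Payment

variable [MeasurableSpace (quasiSplit (↥(maximalRealSubfield L)) L (IsCMField.complexConj L) 2).Adelic] [BorelSpace (quasiSplit (↥(maximalRealSubfield L)) L (IsCMField.complexConj L) 2).Adelic]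
  [MeasurableSpace (AdeleRing (𝓞 L) L)ˣ] [BorelSpace (AdeleRing (𝓞 L) L)ˣ]

/-- **LETTER (O) PAID (pairwise `hOD`)**: at a level datum `(K′, ω)`, for a block-model family `U b` over the C7 index `S_ω(K′)`, `(⨆_b At_b) ⟂ (⨆_b Ln_b)` — the bytes of `hO ℓ` of ★
`residual_le_topologicalClosure_iSup_charLines_of_letters` at `At ℓ b := resHAtom L μ (U ℓ b) (K' ℓ) (ω ℓ) ↑b`, `Ln ℓ b := resHLine …`.  VISIBLE LETTERS: ★ R6's structural data
`νG μK νI 𝓕I ν 𝓕` and per-index `hu` (unitarity), `hχb` (continuous sections are bounded), and the model letter `hOD` (the associate pair: `b ≠ b′`, `χ_b = χ_{b′}ʷ` ⟹ `At_b = ⊥`).  Proof: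
§1 with, for `b ≠ b′`, either `hOD` or ★ R6 `isOrtho_topologicalClosure_span_family_of_rayTrivial_of_ne` (ray-triviality is the index condition). [cite: MoeglinWaldspurger1995, II.2.1, VI.2] [cite: TateThesis1967, §4.3] -/
theorem isOrtho_iSup_resHAtom_iSup_resHLine_of_letters
    [(quasiSplit (↥(maximalRealSubfield L)) L (IsCMField.complexConj L) 2).IsAutomorphicMeasure μ]
    (νG : Measure (quasiSplit (↥(maximalRealSubfield L)) L (IsCMField.complexConj L) 2).Adelic) [νG.IsHaarMeasure] [νG.IsInvInvariant]
    (μK : Measure ((standardMaximalCompactGL 2 L).comap (adelicVal (↥(maximalRealSubfield L)) L (IsCMField.complexConj L) 2 ((StdForm.antidiagonal 2).over L)) : Subgroup (quasiSplit (↥(maximalRealSubfield L)) L (IsCMField.complexConj L) 2).Adelic)) [μK.IsHaarMeasure]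
    (νI : Measure (AdeleRing (𝓞 L) L)ˣ) [νI.IsHaarMeasure]
    {𝓕I : Set (AdeleRing (𝓞 L) L)ˣ} (h𝓕I : IsIdeleClassDomain L 𝓕I)
    (ν : Measure ↥(adelicUnipotent (↥(maximalRealSubfield L)) L (IsCMField.complexConj L) 2)) [ν.IsHaarMeasure] {𝓕 : Set ↥(adelicUnipotent (↥(maximalRealSubfield L)) L (IsCMField.complexConj L) 2)}
    (h𝓕N : IsFundamentalDomain ↥(rationalUnipotent (↥(maximalRealSubfield L)) L (IsCMField.complexConj L) 2) 𝓕 ν) (h𝓕c : IsCompact (closure 𝓕)) (h𝓕₀ : ν 𝓕 ≠ 0)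
    (K' : Subgroup (quasiSplit (↥(maximalRealSubfield L)) L (IsCMField.complexConj L) 2).Adelic) (ω : ↥K' →* ℂ)
    {A Λ : ↥{χ : HeckeCharacter L | (∀ r : ℝ≥0ˣ, χ (posRealIdele L r) = 1) ∧ chiSectionSpace χ K' (ω : ↥K' → ℂ) ≠ ⊥} → Type*}
    [∀ b, AddCommGroup (A b)] [∀ b, Module ℂ (A b)] [∀ b, AddCommGroup (Λ b)] [∀ b, Module ℂ (Λ b)]
    (U : ∀ b : ↥{χ : HeckeCharacter L | (∀ r : ℝ≥0ˣ, χ (posRealIdele L r) = 1) ∧ chiSectionSpace χ K' (ω : ↥K' → ℂ) ≠ ⊥},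
      (quasiSplit (↥(maximalRealSubfield L)) L (IsCMField.complexConj L) 2).L2 μ →ₗ[ℂ] A b × Λ b)
    (hu : ∀ b : ↥{χ : HeckeCharacter L | (∀ r : ℝ≥0ˣ, χ (posRealIdele L r) = 1) ∧ chiSectionSpace χ K' (ω : ↥K' → ℂ) ≠ ⊥}, (b : HeckeCharacter L).IsUnitary)
    (hχb : ∀ (b : ↥{χ : HeckeCharacter L | (∀ r : ℝ≥0ˣ, χ (posRealIdele L r) = 1) ∧ chiSectionSpace χ K' (ω : ↥K' → ℂ) ≠ ⊥})
      (φ : (quasiSplit (↥(maximalRealSubfield L)) L (IsCMField.complexConj L) 2).Adelic → ℂ), φ ∈ chiSectionSpace (b : HeckeCharacter L) K' (ω : ↥K' → ℂ) → Continuous φ → ∃ M : ℝ, ∀ g, ‖φ g‖ ≤ M)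
    (hOD : ∀ b b' : ↥{χ : HeckeCharacter L | (∀ r : ℝ≥0ˣ, χ (posRealIdele L r) = 1) ∧ chiSectionSpace χ K' (ω : ↥K' → ℂ) ≠ ⊥},
      b ≠ b' → (b : HeckeCharacter L) = reflectChar (IsCMField.complexConj L) (b' : HeckeCharacter L) → resHAtom L μ (U b) K' ω (b : HeckeCharacter L) = ⊥) :
    (⨆ b, resHAtom L μ (U b) K' ω (b : HeckeCharacter L)) ⟂ (⨆ b, resHLine L μ (U b) K' ω (b : HeckeCharacter L)) := by
  refine isOrtho_iSup_resHAtom_iSup_resHLine_of_pairwise L μ U K' ω (fun b => (b : HeckeCharacter L)) fun b b' hne => ?_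
  by_cases hw : (b : HeckeCharacter L) = reflectChar (IsCMField.complexConj L) (b' : HeckeCharacter L)
  · exact resHAtom_isOrtho_of_eq_bot L μ (U b) K' ω (hOD b b' hne hw) _
  · exact resHAtom_isOrtho_resHBlock_of_isOrtho L μ (U b) K' ω
      (isOrtho_topologicalClosure_span_family_of_rayTrivial_of_ne L μ νG μK νI h𝓕I ν h𝓕N h𝓕c h𝓕₀ K' (ω : ↥K' → ℂ) (hu b) (hu b') b.2.1 b'.2.1
        (fun h => hne (Subtype.ext h)) hw (hχb b) (hχb b'))

/-- **LETTER (O) PAID (intrinsic `hOD`)**: as `isOrtho_iSup_resHAtom_iSup_resHLine_of_letters`, with the model letter in the intrinsic spelling «an OFF-DUAL block (`χ_bʷ ≠ χ_b`) has no pure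
atoms: `At_b = ⊥`» — for the associate pair `b ≠ b′`, `χ_b = χ_{b′}ʷ` one has `χ_bʷ = χ_{b′} ≠ χ_b` by ★ `reflectChar_reflectChar` (the print's binder `hc : c·c = 1`).
[cite: MoeglinWaldspurger1995, II.2.1, VI.2] [cite: TateThesis1967, §4.3] -/
theorem isOrtho_iSup_resHAtom_iSup_resHLine_of_letters'
    [(quasiSplit (↥(maximalRealSubfield L)) L (IsCMField.complexConj L) 2).IsAutomorphicMeasure μ]
    (νG : Measure (quasiSplit (↥(maximalRealSubfield L)) L (IsCMField.complexConj L) 2).Adelic) [νG.IsHaarMeasure] [νG.IsInvInvariant]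
    (μK : Measure ((standardMaximalCompactGL 2 L).comap (adelicVal (↥(maximalRealSubfield L)) L (IsCMField.complexConj L) 2 ((StdForm.antidiagonal 2).over L)) : Subgroup (quasiSplit (↥(maximalRealSubfield L)) L (IsCMField.complexConj L) 2).Adelic)) [μK.IsHaarMeasure]
    (νI : Measure (AdeleRing (𝓞 L) L)ˣ) [νI.IsHaarMeasure]
    {𝓕I : Set (AdeleRing (𝓞 L) L)ˣ} (h𝓕I : IsIdeleClassDomain L 𝓕I)
    (ν : Measure ↥(adelicUnipotent (↥(maximalRealSubfield L)) L (IsCMField.complexConj L) 2)) [ν.IsHaarMeasure] {𝓕 : Set ↥(adelicUnipotent (↥(maximalRealSubfield L)) L (IsCMField.complexConj L) 2)}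
    (h𝓕N : IsFundamentalDomain ↥(rationalUnipotent (↥(maximalRealSubfield L)) L (IsCMField.complexConj L) 2) 𝓕 ν) (h𝓕c : IsCompact (closure 𝓕)) (h𝓕₀ : ν 𝓕 ≠ 0)
    (hc : IsCMField.complexConj L * IsCMField.complexConj L = 1)
    (K' : Subgroup (quasiSplit (↥(maximalRealSubfield L)) L (IsCMField.complexConj L) 2).Adelic) (ω : ↥K' →* ℂ)
    {A Λ : ↥{χ : HeckeCharacter L | (∀ r : ℝ≥0ˣ, χ (posRealIdele L r) = 1) ∧ chiSectionSpace χ K' (ω : ↥K' → ℂ) ≠ ⊥} → Type*}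
    [∀ b, AddCommGroup (A b)] [∀ b, Module ℂ (A b)] [∀ b, AddCommGroup (Λ b)] [∀ b, Module ℂ (Λ b)]
    (U : ∀ b : ↥{χ : HeckeCharacter L | (∀ r : ℝ≥0ˣ, χ (posRealIdele L r) = 1) ∧ chiSectionSpace χ K' (ω : ↥K' → ℂ) ≠ ⊥},
      (quasiSplit (↥(maximalRealSubfield L)) L (IsCMField.complexConj L) 2).L2 μ →ₗ[ℂ] A b × Λ b)
    (hu : ∀ b : ↥{χ : HeckeCharacter L | (∀ r : ℝ≥0ˣ, χ (posRealIdele L r) = 1) ∧ chiSectionSpace χ K' (ω : ↥K' → ℂ) ≠ ⊥}, (b : HeckeCharacter L).IsUnitary)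
    (hχb : ∀ (b : ↥{χ : HeckeCharacter L | (∀ r : ℝ≥0ˣ, χ (posRealIdele L r) = 1) ∧ chiSectionSpace χ K' (ω : ↥K' → ℂ) ≠ ⊥})
      (φ : (quasiSplit (↥(maximalRealSubfield L)) L (IsCMField.complexConj L) 2).Adelic → ℂ), φ ∈ chiSectionSpace (b : HeckeCharacter L) K' (ω : ↥K' → ℂ) → Continuous φ → ∃ M : ℝ, ∀ g, ‖φ g‖ ≤ M)
    (hOD : ∀ b : ↥{χ : HeckeCharacter L | (∀ r : ℝ≥0ˣ, χ (posRealIdele L r) = 1) ∧ chiSectionSpace χ K' (ω : ↥K' → ℂ) ≠ ⊥},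
      reflectChar (IsCMField.complexConj L) (b : HeckeCharacter L) ≠ (b : HeckeCharacter L) → resHAtom L μ (U b) K' ω (b : HeckeCharacter L) = ⊥) :
    (⨆ b, resHAtom L μ (U b) K' ω (b : HeckeCharacter L)) ⟂ (⨆ b, resHLine L μ (U b) K' ω (b : HeckeCharacter L)) := by
  refine isOrtho_iSup_resHAtom_iSup_resHLine_of_letters L μ νG μK νI h𝓕I ν h𝓕N h𝓕c h𝓕₀ K' ω U hu hχb fun b b' hne hw => hOD b ?_
  -- `χ_b = χ_{b′}ʷ` and `b ≠ b′` ⟹ `χ_bʷ = χ_{b′} ≠ χ_b`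
  rw [hw, reflectChar_reflectChar hc]
  exact fun h => hne (Subtype.ext (hw.trans h.symm))

end Payment

end Summit.HodgeConjecture.HodgeConjecture.R90.S8

end
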